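/-
Origin: expansion seat `planner-pub-hodgecm-pv01-g5-0`, handover #6 2026-08-18T09:56:29Z (`HOME/pub-hodgecm-pv01-g5/lean/Pv01g5/EndStateSignRecipe.lean`, md5 f3e97ef7, 238 lines);
landed by the gen-7 packager in gate run 28 as `HodgeCM/PerL34/EndStateSignRecipe.lean` (import ^import Pv[0-9]+g[0-9]+\.→import HodgeCM.PerL34. ×2).
-/
/-
# The PerL END STATE over a RE-SIGNED theta model: the DESIGN binder h12b discharged by construction

Origin: DAG-node prover seat `planner-pub-hodgecm-pv01-g5-0` (gen 5 of `pub-hodgecm-pv01`), 2026-08-18, handover #6,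
for gate run 28.  NEW additive leaf under `HodgeCM/PerL34/`.  Imports (tree only): `HodgeCM.PerL34.N12bSignRecipe`
(prl1-g5, run 27: `ThetaModel.withSignRecipe`, `N12b_signRecipe_withSignRecipe`), `HodgeCM.PerL34.EndStateLinks` and
`HodgeCM.PerL34.EndStateHCCM` (this seat, run 26).  Mathlib + the package only; `#print axioms` ⊆ {propext,
Classical.choice, Quot.sound}; no placeholders.  Nothing cited, nothing posited (ABSOLUTE RULE): compositions of
landed theorems and definitional unfoldings.

Purpose (binder census of the headline of record, continued).  `EndStateLinks.endState_iff_prints_dictLeaves` says the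
thirteen non-`M` binders of `AssemblyRoutes.perL_of_openCharsWeilLeavesCRΔ` are worth EXACTLY five PRINT/MODEL/DESIGN facts
(h07, h09a, h09b P-anchored; hM38 = M38 a class-M model fact; h12b DESIGN) plus the seven dictionary leaves.  prl1-g5 (`N12bSignRecipe`, run 27) observed at NODE
level (`perL_of_nodes_signRecipe`) that the DESIGN binder h12b (`N12b_signRecipe T` = the conjugation behaviour of the
model's own sign data `kappa`, `frameSign`) is a THEOREM for any model re-signed with PerL's recipe,
`T.withSignRecipe h` (`h : Bool` the convention bit).  This file records the same move for the END STATE OF RECORD: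

* `reqPos_withSignRecipe`, `signsForced_withSignRecipe`, `goodCtx_withSignRecipe_iff` — re-signing changes EXACTLY
  the guard `GoodCtx` of the open binders (through `reqPos`/`SignsForced`), and the new guard depends on `h` only,
  not on `T` (so all re-signed models quantify their open inputs over the SAME seesaw contexts: those whose datum
  carries PerL's own forced signs); `goodCtx_withSignRecipe_iff_self` — for a model already carrying the recipe the
  guard is unchanged (`withSignRecipe_eq_self`);
* `EndStatePrints4 T` — the four remaining facts: three P-anchored (h07, h09a, h09b) + the class-M model fact M38
  (hM38; referee A G1/G22: its print anchor is provenance only) (stated for `T` itself: N09a/N09b are literally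
  the same statements for `T` and `T.withSignRecipe h`); `endStatePrints_withSignRecipe_iff :
  EndStatePrints (T.withSignRecipe h) ↔ EndStatePrints4 T` (h12b discharged);
* `endState_withSignRecipe_iff (M) (hcov) : EndState (T.withSignRecipe h) Pc ↔ EndStatePrints4 T ∧
  DictLeaves (T.withSignRecipe h) Pc` — over re-signed models the end state is worth FOUR facts (3 P + M38) + the seven
  dictionary leaves (modulo `M` and the definitional `Fact_coverTheta`, as in `EndStateLinks`);
* the writer-facing explicit forms with TWELVE non-`M` binders (h12b gone; the eight open/dictionary binders over
  the re-signed model): `perL_of_openCharsWeilLeavesCRΔ_signRecipe : … → U.PerL`,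
  `perL44_of_openCharsWeilLeavesCRΔ_signRecipe : … → U.PerL44`, and
  `hcCM_of_openCharsWeilLeavesCRΔ_signRecipe_descentFacts : M → ⟨12⟩ → (E8) → U.HC_CM` (binders M + 12 + 8).

What this does NOT say: the open binders over `T.withSignRecipe h` are NOT the open binders over `T` (their guard
differs unless `T.kappa`/`T.frameSign` already are the recipe) — re-signing moves the sign recipe from a DESIGN
hypothesis into the STATEMENTS of the open inputs, which is where PerL Def 3.2 ("with the forced signs") has it.
-/
import Summits.HodgeConjecture.HodgeCM.PerL34.N12bSignRecipe
import Summits.HodgeConjecture.HodgeCM.PerL34.EndStateLinks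
import Summits.HodgeConjecture.HodgeCM.PerL34.EndStateHCCM

noncomputable section

open HodgeCM.Prior.Perl34File HodgeCM.Prior.Perl34File.Perl34 HodgeCM.PerL34.ArchC

namespace HodgeCM

namespace PerL34

namespace EndStateSignRecipe

open Universe Universe.ThetaModel AssemblyRoutes EndStateShadow EndStateCensus EndStateLinks CharSpansFinal

variable {U : Universe} (T : U.ThetaModel) (h : Bool)

/-! ## What re-signing changes: exactly the guard `GoodCtx`, and the new guard depends on `h` only -/

/-- The required signs of a re-signed model are PerL's recipe — independent of the model. -/
theorem reqPos_withSignRecipe (T T' : U.ThetaModel) :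
    (T.withSignRecipe h).reqPos = (T'.withSignRecipe h).reqPos := rfl

/-- Hence so are the forced-sign conditions. -/
theorem signsForced_withSignRecipe (T T' : U.ThetaModel) :
    (T.withSignRecipe h).SignsForced = (T'.withSignRecipe h).SignsForced := rfl

/-- **The guard of the open binders of a re-signed model depends on the convention bit `h` only, not on `T`.** -/
theorem goodCtx_withSignRecipe_iff (T T' : U.ThetaModel) {L : CMField} (ι₁ : L →+* ℂ) (c : SeesawCtx L) :
    (T.withSignRecipe h).GoodCtx ι₁ c ↔ (T'.withSignRecipe h).GoodCtx ι₁ c := by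
  constructor
  · rintro ⟨h1, h2, h3, j, hj, hs⟩
    exact ⟨h1, h2, h3, j, hj, by rw [signsForced_withSignRecipe h T' T]; exact hs⟩
  · rintro ⟨h1, h2, h3, j, hj, hs⟩
    exact ⟨h1, h2, h3, j, hj, by rw [signsForced_withSignRecipe h T T']; exact hs⟩

/-- For a model whose sign data already ARE the recipe, re-signing changes nothing — in particular not the guard. -/
theorem goodCtx_withSignRecipe_iff_self (hk : T.kappa = SignRecipe.kappa h) (hf : T.frameSign = SignRecipe.frameSign)
    {L : CMField} (ι₁ : L →+* ℂ) (c : SeesawCtx L) :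
    (T.withSignRecipe h).GoodCtx ι₁ c ↔ T.GoodCtx ι₁ c := by
  rw [ThetaModel.withSignRecipe_eq_self T h hk hf]

/-- The definitional `Fact_coverTheta` (used by `EndStateLinks.endState_iff_prints_dictLeaves`) is literally the
same statement for `T` and its re-signing (it reads `Theta` and `cover` only). -/
theorem fact_coverTheta_withSignRecipe_iff : (T.withSignRecipe h).Fact_coverTheta ↔ T.Fact_coverTheta := Iff.rfl

/-- So is S6's `Fact_thetaAlbanese`?  No: it is guarded by `GoodCtx`; we only record that the TRACE-level print
facts N09a/N09b transfer verbatim (prl1-g5) — restated here for the reader of this file. -/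
example : N09a_embCover (T.withSignRecipe h) ↔ N09a_embCover T := N09a_withSignRecipe_iff T h
example : N09b_innerEmb (T.withSignRecipe h) ↔ N09b_innerEmb T := N09b_withSignRecipe_iff T h

/-! ## The print/model facts of the end state over a re-signed model: four, not five -/

/-- **The four remaining facts** of the end state (h12b DESIGN dropped): the three P-anchored facts N07 HR(2,0), N09a
`embCover`, N09b `innerEmb`, and the class-M model fact M38 `cmInflation` (referee A G1/G22: NOT a print fact; its
Shimura anchor is provenance only) — stated for `T` itself. -/
structure EndStatePrints4 : Prop where
  h07 : N07_hodgeRiemann20 U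
  h09a : N09a_embCover T
  h09b : N09b_innerEmb T
  hM38 : U.Fact_cmInflation

variable {T}

/-- (Ported verbatim from the HodgeCMPerL package; no docstring in the source.) -/
theorem EndStatePrints4.ofPrints (P : EndStatePrints T) : EndStatePrints4 T := ⟨P.h07, P.h09a, P.h09b, P.hM38⟩

/-- Over the re-signed model the four facts ARE the five: h12b is the theorem
`N12b_signRecipe_withSignRecipe`. -/
theorem EndStatePrints4.printsWithSignRecipe (P : EndStatePrints4 T) : EndStatePrints (T.withSignRecipe h) :=
  ⟨P.h07, (N09a_withSignRecipe_iff T h).2 P.h09a, (N09b_withSignRecipe_iff T h).2 P.h09b, P.hM38,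
    N12b_signRecipe_withSignRecipe T h⟩

/-- **h12b discharged.** `EndStatePrints (T.withSignRecipe h) ↔ EndStatePrints4 T`. -/
theorem endStatePrints_withSignRecipe_iff : EndStatePrints (T.withSignRecipe h) ↔ EndStatePrints4 T :=
  ⟨fun P => ⟨P.h07, (N09a_withSignRecipe_iff T h).1 P.h09a, (N09b_withSignRecipe_iff T h).1 P.h09b, P.hM38⟩,
    fun P => P.printsWithSignRecipe h⟩

/-- The print/model facts of a re-signed model do not depend on the convention bit. -/
theorem endStatePrints_withSignRecipe_iff_bit (h h' : Bool) :
    EndStatePrints (T.withSignRecipe h) ↔ EndStatePrints (T.withSignRecipe h') :=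
  (endStatePrints_withSignRecipe_iff h).trans (endStatePrints_withSignRecipe_iff h').symm

/-! ## The end state over a re-signed model -/

variable {Pc : ∀ {L : CMField} {ι₁ : L →+* ℂ} (V : HermSpace3 L ι₁) (c : SeesawCtx L),
  C4a.PointedCore (T.core V c)}

/-- **EXACT WORTH of the end state over a re-signed model**: FOUR facts (three P-anchored + M38) + the seven dictionary leaves
(modulo `M` and the definitional `Fact_coverTheta`).  Compare `EndStateLinks.endState_iff_prints_dictLeaves`
(five + seven). -/
theorem endState_withSignRecipe_iff (M : U.ModelAxioms) (hcov : T.Fact_coverTheta) :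
    EndState (T.withSignRecipe h) Pc ↔ EndStatePrints4 T ∧ DictLeaves (T.withSignRecipe h) Pc :=
  (endState_iff_prints_dictLeaves (T := T.withSignRecipe h) (Pc := Pc) M
      ((fact_coverTheta_withSignRecipe_iff T h).2 hcov)).trans
    (and_congr_left' (endStatePrints_withSignRecipe_iff h))

/-- Records form: the end state over a re-signed model ↔ the four facts (3 P + M38) + the headline bundle (no `M`, no
`Fact_coverTheta` needed in this direction-free form). -/
theorem endState_withSignRecipe_iff_headlineBundle :
    EndState (T.withSignRecipe h) Pc ↔ EndStatePrints4 T ∧ HeadlineBundle (T.withSignRecipe h) Pc :=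
  (endState_iff_prints_headlineBundle (T := T.withSignRecipe h) (Pc := Pc)).trans
    (and_congr_left' (endStatePrints_withSignRecipe_iff h))

/-- The end state over a re-signed model from the four facts (3 P + M38) and the dictionary leaves. -/
theorem endState_withSignRecipe_of_dictLeaves (M : U.ModelAxioms) (P : EndStatePrints4 T) (hcov : T.Fact_coverTheta)
    (hD : DictLeaves (T.withSignRecipe h) Pc) : EndState (T.withSignRecipe h) Pc :=
  endState_of_dictLeaves M (P.printsWithSignRecipe h) ((fact_coverTheta_withSignRecipe_iff T h).2 hcov) hD

/-- `U.PerL` from the four facts (3 P + M38) and the dictionary leaves of a re-signed model. -/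
theorem perL_of_prints4_dictLeaves (M : U.ModelAxioms) (P : EndStatePrints4 T)
    (hD : DictLeaves (T.withSignRecipe h) Pc) : U.PerL :=
  perL_of_prints_dictLeaves M (P.printsWithSignRecipe h) hD

/-! ## Writer-facing explicit forms: TWELVE non-`M` binders (h12b gone) -/

/-- **PerL v5 Theorem 4.4 (wall form `U.PerL`) from the headline's binders with h12b DISCHARGED**: the model is
re-signed with PerL's recipe; h07, h09a, h09b, hM38 as in the headline of record (h09a/h09b stated for `T`); the
eight open/dictionary binders for the re-signed model `T.withSignRecipe h`.  Compare
`AssemblyRoutes.perL_of_openCharsWeilLeavesCRΔ` (thirteen binders). -/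
theorem perL_of_openCharsWeilLeavesCRΔ_signRecipe (M : U.ModelAxioms) (T : U.ThetaModel) (h : Bool)
    (h07 : N07_hodgeRiemann20 U) (h09a : N09a_embCover T) (h09b : N09b_innerEmb T)
    (hM38 : U.Fact_cmInflation) (hAlb : (T.withSignRecipe h).Fact_thetaAlbanese)
    (hbr : ∀ {L : CMField} {ι₁ : L →+* ℂ} (V : HermSpace3 L ι₁) (c : SeesawCtx L), (T.withSignRecipe h).GoodCtx ι₁ c →
      Nonempty (SeesawDictionary.SeesawBridge (T.withSignRecipe h) V c ((T.withSignRecipe h).t12 V c) 0 1))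
    (hQ : ∀ {L : CMField} {ι₁ : L →+* ℂ} (V : HermSpace3 L ι₁) (c : SeesawCtx L), (T.withSignRecipe h).GoodCtx ι₁ c →
      Nonempty (QautDictionary.QautBridge (T.withSignRecipe h) V c ((T.withSignRecipe h).t34 V c) 2 3))
    (Pc : ∀ {L : CMField} {ι₁ : L →+* ℂ} (V : HermSpace3 L ι₁) (c : SeesawCtx L),
      C4a.PointedCore ((T.withSignRecipe h).core V c))
    (A12 : ∀ {L : CMField} {ι₁ : L →+* ℂ} (V : HermSpace3 L ι₁) (c : SeesawCtx L),
      (T.withSignRecipe h).GoodCtx ι₁ c →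
        Nonempty (ArchCDatum ((T.withSignRecipe h).core V c) ((T.withSignRecipe h).t12 V c) (Pc V c)))
    (A34 : ∀ {L : CMField} {ι₁ : L →+* ℂ} (V : HermSpace3 L ι₁) (c : SeesawCtx L),
      (T.withSignRecipe h).GoodCtx ι₁ c →
        Nonempty (ArchCDatum ((T.withSignRecipe h).core V c) ((T.withSignRecipe h).t34 V c) (Pc V c)))
    (hch : (T.withSignRecipe h).Open_chars) (hW : CharSpansFinal.WeilStepsInputCRΔ (T.withSignRecipe h)) : U.PerL :=
  perL_of_openCharsWeilLeavesCRΔ M (T.withSignRecipe h) h07 ((N09a_withSignRecipe_iff T h).2 h09a)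
    ((N09b_withSignRecipe_iff T h).2 h09b) hM38 hAlb (N12b_signRecipe_withSignRecipe T h) hbr hQ Pc A12 A34 hch hW

/-- **PerL v5 Theorem 4.4 AS PRINTED (`U.PerL44`) with h12b DISCHARGED** (same twelve binders; compare
`EndStateThm44.perL44_of_openCharsWeilLeavesCRΔ`). -/
theorem perL44_of_openCharsWeilLeavesCRΔ_signRecipe (M : U.ModelAxioms) (T : U.ThetaModel) (h : Bool)
    (h07 : N07_hodgeRiemann20 U) (h09a : N09a_embCover T) (h09b : N09b_innerEmb T)
    (hM38 : U.Fact_cmInflation) (hAlb : (T.withSignRecipe h).Fact_thetaAlbanese)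
    (hbr : ∀ {L : CMField} {ι₁ : L →+* ℂ} (V : HermSpace3 L ι₁) (c : SeesawCtx L), (T.withSignRecipe h).GoodCtx ι₁ c →
      Nonempty (SeesawDictionary.SeesawBridge (T.withSignRecipe h) V c ((T.withSignRecipe h).t12 V c) 0 1))
    (hQ : ∀ {L : CMField} {ι₁ : L →+* ℂ} (V : HermSpace3 L ι₁) (c : SeesawCtx L), (T.withSignRecipe h).GoodCtx ι₁ c →
      Nonempty (QautDictionary.QautBridge (T.withSignRecipe h) V c ((T.withSignRecipe h).t34 V c) 2 3))
    (Pc : ∀ {L : CMField} {ι₁ : L →+* ℂ} (V : HermSpace3 L ι₁) (c : SeesawCtx L),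
      C4a.PointedCore ((T.withSignRecipe h).core V c))
    (A12 : ∀ {L : CMField} {ι₁ : L →+* ℂ} (V : HermSpace3 L ι₁) (c : SeesawCtx L),
      (T.withSignRecipe h).GoodCtx ι₁ c →
        Nonempty (ArchCDatum ((T.withSignRecipe h).core V c) ((T.withSignRecipe h).t12 V c) (Pc V c)))
    (A34 : ∀ {L : CMField} {ι₁ : L →+* ℂ} (V : HermSpace3 L ι₁) (c : SeesawCtx L),
      (T.withSignRecipe h).GoodCtx ι₁ c →
        Nonempty (ArchCDatum ((T.withSignRecipe h).core V c) ((T.withSignRecipe h).t34 V c) (Pc V c)))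
    (hch : (T.withSignRecipe h).Open_chars) (hW : CharSpansFinal.WeilStepsInputCRΔ (T.withSignRecipe h)) : U.PerL44 :=
  EndStateThm44.perL44_of_openCharsWeilLeavesCRΔ M (T.withSignRecipe h) h07 ((N09a_withSignRecipe_iff T h).2 h09a)
    ((N09b_withSignRecipe_iff T h).2 h09b) hM38 hAlb (N12b_signRecipe_withSignRecipe T h) hbr hQ Pc A12 A34 hch hW

/-- **`HC_CM` END TO END with h12b DISCHARGED: `M` + twelve PerL-side binders + the eight (E8) [QW8]-side facts.**
Compare `HodgeCM.PerL34.hcCM_of_openCharsWeilLeavesCRΔ_descentFacts` (M + 13 + 8). -/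
theorem hcCM_of_openCharsWeilLeavesCRΔ_signRecipe_descentFacts (M : U.ModelAxioms) (T : U.ThetaModel) (h : Bool)
    (h07 : N07_hodgeRiemann20 U) (h09a : N09a_embCover T) (h09b : N09b_innerEmb T)
    (hM38 : U.Fact_cmInflation) (hAlb : (T.withSignRecipe h).Fact_thetaAlbanese)
    (hbr : ∀ {L : CMField} {ι₁ : L →+* ℂ} (V : HermSpace3 L ι₁) (c : SeesawCtx L), (T.withSignRecipe h).GoodCtx ι₁ c →
      Nonempty (SeesawDictionary.SeesawBridge (T.withSignRecipe h) V c ((T.withSignRecipe h).t12 V c) 0 1))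
    (hQ : ∀ {L : CMField} {ι₁ : L →+* ℂ} (V : HermSpace3 L ι₁) (c : SeesawCtx L), (T.withSignRecipe h).GoodCtx ι₁ c →
      Nonempty (QautDictionary.QautBridge (T.withSignRecipe h) V c ((T.withSignRecipe h).t34 V c) 2 3))
    (Pc : ∀ {L : CMField} {ι₁ : L →+* ℂ} (V : HermSpace3 L ι₁) (c : SeesawCtx L),
      C4a.PointedCore ((T.withSignRecipe h).core V c))
    (A12 : ∀ {L : CMField} {ι₁ : L →+* ℂ} (V : HermSpace3 L ι₁) (c : SeesawCtx L),
      (T.withSignRecipe h).GoodCtx ι₁ c →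
        Nonempty (ArchCDatum ((T.withSignRecipe h).core V c) ((T.withSignRecipe h).t12 V c) (Pc V c)))
    (A34 : ∀ {L : CMField} {ι₁ : L →+* ℂ} (V : HermSpace3 L ι₁) (c : SeesawCtx L),
      (T.withSignRecipe h).GoodCtx ι₁ c →
        Nonempty (ArchCDatum ((T.withSignRecipe h).core V c) ((T.withSignRecipe h).t34 V c) (Pc V c)))
    (hch : (T.withSignRecipe h).Open_chars) (hW : CharSpansFinal.WeilStepsInputCRΔ (T.withSignRecipe h))
    (hN1 : U.Fact_cupExterior) (hN2 : U.Fact_cup_hodge) (hN3 : U.Fact_pull_H0) (hN4 : U.Fact_hodge_F0)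
    (h4 : U.Fact_cupAlg) (h5 : U.Fact_cupAssoc) (h7d : U.Fact_gysinDescent) (hd : U.Fact_dimProd) : U.HC_CM :=
  HodgeCM.PerL34.hcCM_of_openCharsWeilLeavesCRΔ_descentFacts M (T.withSignRecipe h) h07
    ((N09a_withSignRecipe_iff T h).2 h09a) ((N09b_withSignRecipe_iff T h).2 h09b) hM38 hAlb
    (N12b_signRecipe_withSignRecipe T h) hbr hQ Pc A12 A34 hch hW hN1 hN2 hN3 hN4 h4 h5 h7d hd

/-- Structure form: every conclusion of record from `M`, the four facts (3 P + M38), the headline bundle of a re-signed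
model and the (E8) facts. -/
theorem endToEnd_signRecipe (M : U.ModelAxioms) (P : EndStatePrints4 T)
    (B : HeadlineBundle (T.withSignRecipe h) Pc)
    (hN1 : U.Fact_cupExterior) (hN2 : U.Fact_cup_hodge) (hN3 : U.Fact_pull_H0) (hN4 : U.Fact_hodge_F0)
    (h4 : U.Fact_cupAlg) (h5 : U.Fact_cupAssoc) (h7d : U.Fact_gysinDescent) (hd : U.Fact_dimProd) :
    U.HC_CM ∧ U.PerL44 ∧ U.PerL ∧ U.PeriodThmF ∧ U.W_RK4 :=
  EndStateHCCM.endToEnd M ((endState_withSignRecipe_iff_headlineBundle h).2 ⟨P, B⟩) hN1 hN2 hN3 hN4 h4 h5 h7d hd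

end EndStateSignRecipe

end PerL34

end HodgeCM

end
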